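import Summits.QuantumFields.BalabanUV.Beta.D1BFx.MixedVarPackedHess

/-!
# `BalabanUV.Beta.D1BFx.WardJetsFromNoether` — road «BF-x» for binder row D1, slot (K), X₃(ii) ROUTE T, TB4 brick **K-TA4W**
# «WARD JETS FROM NOETHER + KKT» (MODEL): the eighteen jet-level Ward binders `(a0)…(bₛₜ)` of
# `MixedVarPackedHess.hessT_sliceTransfer_jets` for the TOTAL background jets of a bordered-Hessian family, derived from the
# OFF-SHELL NOETHER JETS of the PARTIAL tables and the KKT source structure of the response — pure finite-dimensional algebra

HONEST DEPENDENCY (cell records, verbatim): «continuum YM on T⁴ ⇐ BetaPertH ∧ nine spine estimates (0/9 proved); BetaPertH ⇐ (D1) ∧ (D4) ∧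
CAP+tail; G-an2-4 gates asym, D1 and NE2/3/4.»  HONEST FRAMING (cell contract, verbatim): «discharging `BetaPertH` makes Bałaban's UV stability
UNCONDITIONAL — a real constructive-QFT result; it is NOT the continuum limit and NOT the Clay problem.»  THIS MODULE DISCHARGES NOTHING of (K),
of D1 or of the wall: it is [folklore] finite-dimensional matrix algebra (Mathlib) over ABSTRACT data.  ONE bookkeeping data definition
(`oslot`), no `def … : Prop`, nothing cited, 0 sorry.  It instantiates NO table of the cell.  NOT D1, NOT BetaPertH, NOT continuum, NOT Clay.

ABSOLUTE RULE (cell charter, verbatim): «No internally-minted statement may enter as a cited fact. Every hypothesis is either kernel-proved in this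
package or a verbatim quotation of a PUBLISHED theorem with page reference. The manuscript(s) under audit are NOT citable for their own disputed
steps — they are the thing under adjudication; programme-internal (2001/route/tribunal) claims are never citable.»

WHERE THIS SITS (`HOME/b2b-balaban-beta-d1-p2/K-ASSEMBLY-SPEC-v2.md` §3 with the v2.3 amendment, owner rulings ρ-g6-9 (2) and ρ-g6-11 (4)).
The model identity `hessT_sliceTransfer_jets` (brick TA4) carries EIGHTEEN algebraic Ward binders: the `(s,t)`-jets up to order two of
`K(B)·W(B) = 0`, `K(B)ᵀ·W(B) = 0`, `Q(B)·W(B) = 0` (Hessian, constraint linearisation, fluctuation pure-gauge modes along the constrained-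
minimiser family).  The cell's literal is NOT a smooth family: its jets are ASSEMBLED from PARTIAL fine-field / multiplier tables by the
chain rule through a packed resolvent (`SecondOrderResponse`'s typed convention: first jets `dM K N S M = Σ colH•S + Σ colM•M`, second
jets `W2OfK = vertex2OfK S₂ + mixOfK M₂ + mixOfK M₂ᵗ + dM (K2OfK …)`, `K2OfK = −K∘(∂𝕄)∘K`).  THIS FILE is the algebra that turns
TABLE-LEVEL gauge identities into the JET-LEVEL binders for such assembled jets — on any finite index set, hence on every torus after
periodisation (TB4-tables instantiates it there; that is NOT done here).

THE MODEL (informal provenance of the hypotheses — nothing of this paragraph is asserted in Lean).  Packed variables `ξ = (U, φ)` indexed by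
`σ` (= `ν ⊕ μ`, fine ⊕ multiplier), KKT map `F(ξ) = (∇_U L(U,φ), Q(U) − b)` with `L = A + φ·Q`, bordered operator `𝕄(ξ) = DF(ξ)`
(`= kkt (∂²L) (Q′)` in `Composition.kkt`'s symmetric convention), gauge directions `D̂(U) : ρ′ → σ` (zero multiplier rows).  Invariance of
`A` and `Q` under the residual gauge group reads `Σ_i ∂_iL(ξ)·D̂(U)_{ia} = 0` and `Q′(U)·D(U) = 0` for ALL `ξ`, i.e. OFF-SHELL
`𝕄(ξ)·D̂(ξ) + R(ξ) = 0` with `R_{ja} = Σ_i ∂_iL·∂_jD̂_{ia}`.  Its `∂_k` and `∂_k∂_l` at an ON-SHELL base (`∇_U L = 0`) are the hypotheses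
[P1] and [P2] below, the `R`-derivatives being the `oslot` terms (weights on the COMPONENT slot of the generator table — the «other slot»).
The response to the prescribed coarse field `b` has its SOURCE IN THE MULTIPLIER ROWS (`𝕄₀·r_s = e_{inr s}`, `𝕄₀·r_{st} = −𝕄_t·r_s`),
and generator tables have NO multiplier rows — so every `oslot` term dies on contraction with the response: that is the whole proof.

CONTENT (all [folklore] unless marked [our object]; ONE module per owner ruling ρ-g6-12 (2): «GO as a MODEL brick, one file» — under the
literal of record (R2) the Ward letters close KINEMATICALLY with a `B`-independent gauge basis, so this brick documents the general
mechanism and the contentful rooted case (R1); it is not on ROUTE T's critical path).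
* §1 `oslot X w := of fun j a ↦ Σ i, w i * X j i a` [our object] — the other-slot reading of a generator table; linearity in the weight and
  THE CONTRACTION RULE `sum_smul_oslot_col` (`Σ_k r_k • oslot X (col_k M) = oslot X (M *ᵥ r)`), with its two-index variants.
* §2 PACKED FORM (any finite `σ`, `ρ`; no symmetry, no inverse): **`packedWard₁`** — [P1] `∀ k, 𝕄₁ k·Ŵ₀ + 𝕄₀·X₁ k + oslot X₁ (col_k 𝕄₀) = 0`
  and `oslot X₁ (𝕄₀ *ᵥ r) = 0` give `𝕄[r]·Ŵ₀ + 𝕄₀·X[r] = 0` for the total jets `𝕄[r] := Σ_k r_k•𝕄₁ k`, `X[r] := Σ_k r_k•X₁ k`;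
  **`packedWard₂`** — [P1], [P2] `∀ k l, 𝕄₂ k l·Ŵ₀ + 𝕄₁ k·X₁ l + 𝕄₁ l·X₁ k + 𝕄₀·X₂ k l + oslot X₁ (i ↦ 𝕄₁ l i k) + oslot (X₂ l) (col_k 𝕄₀)
  + oslot (X₂ k) (col_l 𝕄₀) = 0` and the three source annihilations (`oslot (X₂ ·) (𝕄₀ *ᵥ r_s) = 0`, the same for `r_t`,
  `oslot X₁ (𝕄₀ *ᵥ r_st + 𝕄_t *ᵥ r_s) = 0`) give `𝕄_st·Ŵ₀ + 𝕄_s·Ŵ_t + 𝕄_t·Ŵ_s + 𝕄₀·Ŵ_st = 0` for the assembled second jets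
  `𝕄_st := Σ_{k,l} r_s^k r_t^l•𝕄₂ k l + Σ_k r_st^k•𝕄₁ k`, `Ŵ_st := Σ_{k,l} r_s^k r_t^l•X₂ k l + Σ_k r_st^k•X₁ k` (`s = t` included).
* §3 THE SLOT-EXCHANGE BRIDGE: the CONGRUENCE form in which the tree's letters are written (`divV S = conjV 𝕄₀ X`-shape: the partial tables
  contracted in the DIRECTION slot with a gauge direction are an infinitesimal congruence of the base table) plus SLOT SYMMETRY of the
  partial tables (`𝕄₁ k j i = 𝕄₁ i j k` — third derivatives ∕ `∂_k∂_iQ_m` read in either slot) give the fluctuation-slot jets: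
  **`P1_of_congruence`** ([C1] `Σ_i Ŵ₀ i a • 𝕄₁ i = −((G a)ᵀ·𝕄₀ + 𝕄₀·G a)`, `G a l k = X₁ k l a` ⟹ [P1]; no symmetry of `𝕄₀` used; the
  `conjV 𝕄₀ X = 𝕄₀X − X𝕄₀` dress is `X = −G`, skew), **`P2_of_congruence`** ([C2] = the `∂_l` of [C1]:
  `Σ_i Ŵ₀ i a • 𝕄₂ i l + Σ_i X₁ l i a • 𝕄₁ i = −((G₂ a l)ᵀ·𝕄₀ + 𝕄₀·G₂ a l) − ((G a)ᵀ·𝕄₁ l + 𝕄₁ l·G a) − Σ_i 𝕄₀ i l • H a i`, plus slot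
  symmetry of `𝕄₁`, `𝕄₂` and `X₂ k l = X₂ l k` ⟹ [P2]).
* §4 THE READ-OUT on `σ = ν ⊕ μ` (`𝕄ᵢ = kkt Kᵢ Qᵢ`, `Ŵ = fromRows W 0`): **`ward₁`** — [P1] and «the FIELD rows of `kkt K₀ Q₀ *ᵥ r`
  vanish» give `Kₛ·W₀ + K₀·Wₛ = 0 ∧ Qₛ·W₀ + Q₀·Wₛ = 0`, binders `aₛ`∕`bₛ` of `hessT_sliceTransfer_jets` VERBATIM; the block lemmas it needs.
NOT HERE (staged rc-0 twins in `HOME/b2b-balaban-beta-d1-formalise-leaf-05/g11/`, filed only if the row owner rules (R1)): the order-two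
read-out `ward₂`∕`ward₂_diag` and the `ᵀ`-corollaries (`WardJetsUnpacked.v1.staged.lean`), and the SOURCE CONDITIONS DISCHARGED for an honest
comb-gauged inverse `kkt K₀ [Q₀; τ]` from `K₀ᵀW₀ = 0`, `Q₀W₀ = 0`, `IsUnit (τW₀).det` (`WardJetsCombSources.v1.staged.lean`: the comb
multiplier of a gauge-invariant source vanishes).  Also not here: periodisation, the cell's tables, the letters L1-B∕L2-B∕L2-M∕`hH`∕Wilson
laws and their `Nr` parity remainders, Q-g6-2's composite pairing, colour (K-TA4C).
Provenance: D1 formalisation swarm leaf seat `b2b-balaban-beta-d1-formalise-leaf-05` gen 11 (road «BF-x» brick K-TA4W, CLAIM journal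
2026-08-20T23:11Z), 2026-08-20.
-/

noncomputable section

namespace Summit.QuantumFields.BalabanUV.Beta.D1BFx.WardJetsFromNoether

open Matrix
open scoped BigOperators
open Literature.MathematicalPhysics.QuantumFieldTheory.Balaban1983to89.Beta.Composition (kkt)

/-! ## §1 The other-slot reading of a generator table -/

section OSlot

variable {σ ρ : Type*} [Fintype σ]

/-- [our object] **THE OTHER-SLOT READING.**  For a generator table `X : σ → Matrix σ ρ ℝ` (`X k` = the derivative in packed direction
`k` of the gauge-direction matrix; rows = components, columns = gauge parameters) and weights `w : σ → ℝ`, `oslot X w` is the matrix whose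
row `j` is the `w`-weighted sum over the COMPONENT slot of the direction-`j` table: `(oslot X w) j a = Σ_i w i · X j i a`.  It is the term
the product rule of `∂_k (Σ_i ∂_iL · ∂_jD̂_{ia})` leaves at an on-shell point (`w = col_k 𝕄₀`).  A definition asserting nothing. -/
def oslot (X : σ → Matrix σ ρ ℝ) (w : σ → ℝ) : Matrix σ ρ ℝ :=
  Matrix.of fun j a => ∑ i, w i * X j i a

/-- [folklore] Entries of `oslot` (definitional). -/
@[simp] theorem oslot_apply (X : σ → Matrix σ ρ ℝ) (w : σ → ℝ) (j : σ) (a : ρ) :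
    oslot X w j a = ∑ i, w i * X j i a := rfl

/-- [folklore] `oslot X` is additive in the weight. -/
theorem oslot_add (X : σ → Matrix σ ρ ℝ) (w w' : σ → ℝ) : oslot X (w + w') = oslot X w + oslot X w' := by
  ext j a
  simp [add_mul, Finset.sum_add_distrib]

/-- [folklore] `oslot X` vanishes at weight `0`. -/
theorem oslot_zero (X : σ → Matrix σ ρ ℝ) : oslot X 0 = 0 := by
  ext j a
  simp

/-- [folklore] `oslot X` commutes with scalars in the weight. -/
theorem oslot_smul (X : σ → Matrix σ ρ ℝ) (c : ℝ) (w : σ → ℝ) : oslot X (c • w) = c • oslot X w := by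
  ext j a
  simp [Finset.mul_sum, mul_assoc]

/-- [folklore] THE CONTRACTION RULE: weighting the column read-outs `oslot X (col_k M)` by `r_k` and summing over `k` is the read-out at the
weight `M *ᵥ r` — the step that turns the family of table identities into one identity for the total jet. -/
theorem sum_smul_oslot_col (X : σ → Matrix σ ρ ℝ) (M : Matrix σ σ ℝ) (r : σ → ℝ) :
    ∑ k, r k • oslot X (fun i => M i k) = oslot X (M *ᵥ r) := by
  ext j a
  simp only [Matrix.sum_apply, Matrix.smul_apply, oslot_apply, smul_eq_mul, Matrix.mulVec, dotProduct, Finset.mul_sum,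
    Finset.sum_mul]
  rw [Finset.sum_comm]
  refine Finset.sum_congr rfl fun i _ => Finset.sum_congr rfl fun k _ => ?_
  ring

/-- [folklore] The same contraction rule for a family of tables `X₂ l` weighted in the family index: for each fixed `l` it is
`sum_smul_oslot_col`; here the double sum `Σ_k Σ_l r_k r'_l • oslot (X₂ l) (col_k M) = Σ_l r'_l • oslot (X₂ l) (M *ᵥ r)`. -/
theorem sum_sum_smul_oslot_col (X₂ : σ → σ → Matrix σ ρ ℝ) (M : Matrix σ σ ℝ) (r r' : σ → ℝ) :
    ∑ k, ∑ l, (r k * r' l) • oslot (X₂ l) (fun i => M i k) = ∑ l, r' l • oslot (X₂ l) (M *ᵥ r) := by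
  rw [Finset.sum_comm]
  refine Finset.sum_congr rfl fun l _ => ?_
  rw [← sum_smul_oslot_col, Finset.smul_sum]
  refine Finset.sum_congr rfl fun k _ => ?_
  rw [smul_smul, mul_comm]

/-- [folklore] The contraction rule with the weight read through a table family in the OTHER index:
`Σ_k Σ_l r_k r'_l • oslot X (fun i ↦ N l i k) = oslot X ((Σ_l r'_l • N l) *ᵥ r)`. -/
theorem sum_sum_smul_oslot_table (X : σ → Matrix σ ρ ℝ) (N : σ → Matrix σ σ ℝ) (r r' : σ → ℝ) :
    ∑ k, ∑ l, (r k * r' l) • oslot X (fun i => N l i k) = oslot X ((∑ l, r' l • N l) *ᵥ r) := by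
  have h : ∀ k, ∑ l, (r k * r' l) • oslot X (fun i => N l i k) = r k • oslot X (fun i => (∑ l, r' l • N l) i k) := by
    intro k
    ext j a
    simp only [Matrix.sum_apply, Matrix.smul_apply, oslot_apply, smul_eq_mul, Finset.mul_sum, Finset.sum_mul]
    rw [Finset.sum_comm]
    refine Finset.sum_congr rfl fun i _ => Finset.sum_congr rfl fun l _ => ?_
    ring
  simp_rw [h]
  exact sum_smul_oslot_col X _ r

end OSlot

/-! ## §2 Packed form: the total jets of an assembled family satisfy the jet-level Ward relations -/

section Packed

variable {σ ρ : Type*} [Fintype σ]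

/-- [folklore] Left distributivity of a weighted sum of square tables over a fixed right factor. -/
theorem sum_smul_mul (r : σ → ℝ) (A : σ → Matrix σ σ ℝ) (B : Matrix σ ρ ℝ) :
    (∑ k, r k • A k) * B = ∑ k, r k • (A k * B) := by
  rw [Matrix.sum_mul]
  simp_rw [Matrix.smul_mul]

/-- [folklore] Right distributivity of a fixed left factor over a weighted sum of tables. -/
theorem mul_sum_smul (M : Matrix σ σ ℝ) (r : σ → ℝ) (X : σ → Matrix σ ρ ℝ) :
    M * (∑ k, r k • X k) = ∑ k, r k • (M * X k) := by
  rw [Matrix.mul_sum]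
  simp_rw [Matrix.mul_smul]

/-- [folklore] Product of two weighted sums of tables = the doubly weighted double sum of products. -/
theorem sum_smul_mul_sum_smul (r r' : σ → ℝ) (A : σ → Matrix σ σ ℝ) (X : σ → Matrix σ ρ ℝ) :
    (∑ k, r k • A k) * (∑ l, r' l • X l) = ∑ k, ∑ l, (r k * r' l) • (A k * X l) := by
  rw [Matrix.sum_mul]
  refine Finset.sum_congr rfl fun k _ => ?_
  rw [Matrix.mul_sum]
  refine Finset.sum_congr rfl fun l _ => ?_
  rw [Matrix.smul_mul, Matrix.mul_smul, smul_smul]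

/-- [folklore] **PACKED WARD RELATION, ORDER ONE.**  If every partial table satisfies the off-shell Noether jet
[P1] `𝕄₁ k·Ŵ₀ + 𝕄₀·X₁ k + oslot X₁ (col_k 𝕄₀) = 0`, and the response `r` has its source where the generators have no rows
(`oslot X₁ (𝕄₀ *ᵥ r) = 0`), then the TOTAL jets `𝕄[r] := Σ_k r_k•𝕄₁ k`, `Ŵ[r] := Σ_k r_k•X₁ k` satisfy `𝕄[r]·Ŵ₀ + 𝕄₀·Ŵ[r] = 0`.
No symmetry and no invertibility of anything is used. -/
theorem packedWard₁ (𝕄₀ : Matrix σ σ ℝ) (𝕄₁ : σ → Matrix σ σ ℝ) (Ŵ₀ : Matrix σ ρ ℝ) (X₁ : σ → Matrix σ ρ ℝ)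
    (hP1 : ∀ k, 𝕄₁ k * Ŵ₀ + 𝕄₀ * X₁ k + oslot X₁ (fun i => 𝕄₀ i k) = 0)
    (r : σ → ℝ) (hsrc : oslot X₁ (𝕄₀ *ᵥ r) = 0) :
    (∑ k, r k • 𝕄₁ k) * Ŵ₀ + 𝕄₀ * (∑ k, r k • X₁ k) = 0 := by
  have h : ∑ k, r k • (𝕄₁ k * Ŵ₀ + 𝕄₀ * X₁ k + oslot X₁ (fun i => 𝕄₀ i k)) = 0 :=
    Finset.sum_eq_zero fun k _ => by rw [hP1 k, smul_zero]
  simp only [smul_add, Finset.sum_add_distrib, sum_smul_oslot_col, hsrc, add_zero] at h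
  rwa [sum_smul_mul, mul_sum_smul]

/-- [folklore] **PACKED WARD RELATION, ORDER TWO (mixed; `s = t` included).**  From [P1], the second off-shell Noether jet
[P2] `𝕄₂ k l·Ŵ₀ + 𝕄₁ k·X₁ l + 𝕄₁ l·X₁ k + 𝕄₀·X₂ k l + oslot X₁ (colᵀ: i ↦ 𝕄₁ l i k) + oslot (X₂ l) (col_k 𝕄₀) + oslot (X₂ k) (col_l 𝕄₀) = 0`,
and the source structure of the responses — `oslot (X₂ l) (𝕄₀ *ᵥ r_s) = 0`, `oslot (X₂ k) (𝕄₀ *ᵥ r_t) = 0` («first-order sources in the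
multiplier rows») and `oslot X₁ (𝕄₀ *ᵥ r_st + 𝕄_t *ᵥ r_s) = 0` («`K₂ = −K(∂𝕄)K`») — the assembled second jets
`𝕄_st := Σ_{k,l} r_s^k r_t^l • 𝕄₂ k l + Σ_k r_st^k • 𝕄₁ k`, `Ŵ_st := Σ_{k,l} r_s^k r_t^l • X₂ k l + Σ_k r_st^k • X₁ k` satisfy
`𝕄_st·Ŵ₀ + 𝕄_s·Ŵ_t + 𝕄_t·Ŵ_s + 𝕄₀·Ŵ_st = 0`. -/
theorem packedWard₂ (𝕄₀ : Matrix σ σ ℝ) (𝕄₁ : σ → Matrix σ σ ℝ) (𝕄₂ : σ → σ → Matrix σ σ ℝ)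
    (Ŵ₀ : Matrix σ ρ ℝ) (X₁ : σ → Matrix σ ρ ℝ) (X₂ : σ → σ → Matrix σ ρ ℝ)
    (hP1 : ∀ k, 𝕄₁ k * Ŵ₀ + 𝕄₀ * X₁ k + oslot X₁ (fun i => 𝕄₀ i k) = 0)
    (hP2 : ∀ k l, 𝕄₂ k l * Ŵ₀ + 𝕄₁ k * X₁ l + 𝕄₁ l * X₁ k + 𝕄₀ * X₂ k l
      + oslot X₁ (fun i => 𝕄₁ l i k) + oslot (X₂ l) (fun i => 𝕄₀ i k) + oslot (X₂ k) (fun i => 𝕄₀ i l) = 0)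
    (rs rt rst : σ → ℝ)
    (hs₂ : ∀ l, oslot (X₂ l) (𝕄₀ *ᵥ rs) = 0) (ht₂ : ∀ k, oslot (X₂ k) (𝕄₀ *ᵥ rt) = 0)
    (hst : oslot X₁ (𝕄₀ *ᵥ rst + (∑ l, rt l • 𝕄₁ l) *ᵥ rs) = 0) :
    (∑ k, ∑ l, (rs k * rt l) • 𝕄₂ k l + ∑ k, rst k • 𝕄₁ k) * Ŵ₀
      + (∑ k, rs k • 𝕄₁ k) * (∑ l, rt l • X₁ l) + (∑ l, rt l • 𝕄₁ l) * (∑ k, rs k • X₁ k)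
      + 𝕄₀ * (∑ k, ∑ l, (rs k * rt l) • X₂ k l + ∑ k, rst k • X₁ k) = 0 := by
  -- the doubly weighted sum of [P2] and the `r_st`-weighted sum of [P1] both vanish
  have hA : ∑ k, ∑ l, (rs k * rt l) • (𝕄₂ k l * Ŵ₀ + 𝕄₁ k * X₁ l + 𝕄₁ l * X₁ k + 𝕄₀ * X₂ k l
      + oslot X₁ (fun i => 𝕄₁ l i k) + oslot (X₂ l) (fun i => 𝕄₀ i k) + oslot (X₂ k) (fun i => 𝕄₀ i l)) = 0 :=
    Finset.sum_eq_zero fun k _ => Finset.sum_eq_zero fun l _ => by rw [hP2 k l, smul_zero]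
  have hB : ∑ k, rst k • (𝕄₁ k * Ŵ₀ + 𝕄₀ * X₁ k + oslot X₁ (fun i => 𝕄₀ i k)) = 0 :=
    Finset.sum_eq_zero fun k _ => by rw [hP1 k, smul_zero]
  -- the `oslot` terms of the two sums add up to the three source read-outs
  have hT2 : ∑ k, ∑ l, (rs k * rt l) • oslot (X₂ l) (fun i => 𝕄₀ i k) = 0 := by
    rw [sum_sum_smul_oslot_col]
    exact Finset.sum_eq_zero fun l _ => by rw [hs₂ l, smul_zero]
  have hT3 : ∑ k, ∑ l, (rs k * rt l) • oslot (X₂ k) (fun i => 𝕄₀ i l) = 0 := by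
    rw [Finset.sum_comm]
    have : ∑ l, ∑ k, (rs k * rt l) • oslot (X₂ k) (fun i => 𝕄₀ i l)
        = ∑ l, ∑ k, (rt l * rs k) • oslot (X₂ k) (fun i => 𝕄₀ i l) :=
      Finset.sum_congr rfl fun l _ => Finset.sum_congr rfl fun k _ => by rw [mul_comm]
    rw [this, sum_sum_smul_oslot_col]
    exact Finset.sum_eq_zero fun k _ => by rw [ht₂ k, smul_zero]
  have hT14 : ∑ k, ∑ l, (rs k * rt l) • oslot X₁ (fun i => 𝕄₁ l i k) + ∑ k, rst k • oslot X₁ (fun i => 𝕄₀ i k) = 0 := by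
    rw [sum_sum_smul_oslot_table, sum_smul_oslot_col, ← oslot_add, add_comm, hst]
  -- expand the two vanishing sums and regroup
  simp only [smul_add, Finset.sum_add_distrib] at hA hB
  rw [hT2, hT3, add_zero, add_zero] at hA
  -- the main terms
  have e1 : (∑ k, ∑ l, (rs k * rt l) • 𝕄₂ k l + ∑ k, rst k • 𝕄₁ k) * Ŵ₀
      = ∑ k, ∑ l, (rs k * rt l) • (𝕄₂ k l * Ŵ₀) + ∑ k, rst k • (𝕄₁ k * Ŵ₀) := by
    rw [Matrix.add_mul, sum_smul_mul, Matrix.sum_mul]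
    congr 1
    refine Finset.sum_congr rfl fun k _ => ?_
    rw [Matrix.sum_mul]
    simp_rw [Matrix.smul_mul]
  have e2 : (∑ k, rs k • 𝕄₁ k) * (∑ l, rt l • X₁ l) = ∑ k, ∑ l, (rs k * rt l) • (𝕄₁ k * X₁ l) :=
    sum_smul_mul_sum_smul rs rt 𝕄₁ X₁
  have e3 : (∑ l, rt l • 𝕄₁ l) * (∑ k, rs k • X₁ k) = ∑ k, ∑ l, (rs k * rt l) • (𝕄₁ l * X₁ k) := by
    rw [sum_smul_mul_sum_smul, Finset.sum_comm]
    exact Finset.sum_congr rfl fun k _ => Finset.sum_congr rfl fun l _ => by rw [mul_comm]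
  have e4 : 𝕄₀ * (∑ k, ∑ l, (rs k * rt l) • X₂ k l + ∑ k, rst k • X₁ k)
      = ∑ k, ∑ l, (rs k * rt l) • (𝕄₀ * X₂ k l) + ∑ k, rst k • (𝕄₀ * X₁ k) := by
    rw [Matrix.mul_add, mul_sum_smul, Matrix.mul_sum]
    congr 1
    refine Finset.sum_congr rfl fun k _ => ?_
    rw [Matrix.mul_sum]
    simp_rw [Matrix.mul_smul]
  rw [e1, e2, e3, e4]
  -- now both sides are sums of the same summands
  have key : (∑ k, ∑ l, (rs k * rt l) • (𝕄₂ k l * Ŵ₀) + ∑ k, rst k • (𝕄₁ k * Ŵ₀))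
      + ∑ k, ∑ l, (rs k * rt l) • (𝕄₁ k * X₁ l) + ∑ k, ∑ l, (rs k * rt l) • (𝕄₁ l * X₁ k)
      + (∑ k, ∑ l, (rs k * rt l) • (𝕄₀ * X₂ k l) + ∑ k, rst k • (𝕄₀ * X₁ k))
      = (∑ k, ∑ l, (rs k * rt l) • (𝕄₂ k l * Ŵ₀) + ∑ k, ∑ l, (rs k * rt l) • (𝕄₁ k * X₁ l)
          + ∑ k, ∑ l, (rs k * rt l) • (𝕄₁ l * X₁ k) + ∑ k, ∑ l, (rs k * rt l) • (𝕄₀ * X₂ k l)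
          + ∑ k, ∑ l, (rs k * rt l) • oslot X₁ (fun i => 𝕄₁ l i k))
        + (∑ k, rst k • (𝕄₁ k * Ŵ₀) + ∑ k, rst k • (𝕄₀ * X₁ k) + ∑ k, rst k • oslot X₁ (fun i => 𝕄₀ i k))
        - (∑ k, ∑ l, (rs k * rt l) • oslot X₁ (fun i => 𝕄₁ l i k) + ∑ k, rst k • oslot X₁ (fun i => 𝕄₀ i k)) := by
    abel
  rw [key, hA, hB, hT14, zero_add, sub_zero]

end Packed

/-! ## §3 The slot-exchange bridge: congruence form + slot symmetry ⟹ [P1], [P2] -/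

section Bridge

variable {σ ρ : Type*} [Fintype σ]

/-- [folklore] **[P1] FROM THE CONGRUENCE FORM.**  Suppose the first partial tables are SLOT-SYMMETRIC (`𝕄₁ k j i = 𝕄₁ i j k`: the
direction slot and the column slot carry the same third-order tensor — third derivatives of `L`, or `∂_k∂_iQ_m` read in either slot), and
that contracting the DIRECTION slot with the gauge direction of parameter `a` is an infinitesimal congruence of the base table:
`Σ_i Ŵ₀ i a • 𝕄₁ i = −((G a)ᵀ·𝕄₀ + 𝕄₀·G a)` with the generator OPERATOR `G a` whose column `k` is column `a` of the table `X₁ k`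
(`G a l k = X₁ k l a`).  Then the fluctuation-slot Noether jet [P1] holds for every direction `k`.  (The tree's letter shape
`divV S = conjV 𝕄₀ X = 𝕄₀∘X − X∘𝕄₀` is this with the skew generator `X = −G`; no symmetry of `𝕄₀` is used.) -/
theorem P1_of_congruence (𝕄₀ : Matrix σ σ ℝ) (𝕄₁ : σ → Matrix σ σ ℝ) (Ŵ₀ : Matrix σ ρ ℝ) (X₁ : σ → Matrix σ ρ ℝ)
    (G : ρ → Matrix σ σ ℝ) (hG : ∀ a l k, G a l k = X₁ k l a)
    (hC1 : ∀ a, ∑ i, Ŵ₀ i a • 𝕄₁ i = -((G a)ᵀ * 𝕄₀ + 𝕄₀ * G a))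
    (hslot : ∀ k j i, 𝕄₁ k j i = 𝕄₁ i j k) (k : σ) :
    𝕄₁ k * Ŵ₀ + 𝕄₀ * X₁ k + oslot X₁ (fun i => 𝕄₀ i k) = 0 := by
  ext j a
  have h := congrFun (congrFun (hC1 a) j) k
  simp only [Matrix.sum_apply, Matrix.smul_apply, smul_eq_mul, Matrix.neg_apply, Matrix.add_apply, Matrix.mul_apply,
    Matrix.transpose_apply, hG] at h
  simp only [Matrix.add_apply, Matrix.mul_apply, oslot_apply, Matrix.zero_apply]
  have e : ∑ i, 𝕄₁ k j i * Ŵ₀ i a = ∑ i, Ŵ₀ i a * 𝕄₁ i j k :=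
    Finset.sum_congr rfl fun i _ => by rw [hslot k j i, mul_comm]
  have e2 : ∑ i, 𝕄₀ i k * X₁ j i a = ∑ l, X₁ j l a * 𝕄₀ l k := Finset.sum_congr rfl fun i _ => mul_comm _ _
  rw [e, h, e2]
  ring

/-- [folklore] **[P2] FROM THE CONGRUENCE FORM AT ORDER TWO.**  The `∂_l`-derivative of the order-one congruence identity (taken
off-shell, then evaluated at the on-shell base) reads, for every gauge parameter `a` and direction `l`,
`Σ_i Ŵ₀ i a • 𝕄₂ i l + Σ_i X₁ l i a • 𝕄₁ i = −((G₂ a l)ᵀ·𝕄₀ + 𝕄₀·G₂ a l) − ((G a)ᵀ·𝕄₁ l + 𝕄₁ l·G a) − Σ_i 𝕄₀ i l • H a i`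
with the generator operator `G a` (`G a m j = X₁ j m a`), its derivative `G₂ a l` (`G₂ a l m j = X₂ l j m a`) and the Hessians of the
generator components `H a i` (`H a i j k = X₂ j k i a`) — the shape «divergence of the second table in one background slot = first table
against the generator + commutators» of the tree's second-order letters.  With SLOT SYMMETRY of both partial tables and symmetry of the
second generator table in its two direction slots, this gives the fluctuation-slot Noether jet [P2] for every pair `(k, l)`. -/
theorem P2_of_congruence (𝕄₀ : Matrix σ σ ℝ) (𝕄₁ : σ → Matrix σ σ ℝ) (𝕄₂ : σ → σ → Matrix σ σ ℝ)
    (Ŵ₀ : Matrix σ ρ ℝ) (X₁ : σ → Matrix σ ρ ℝ) (X₂ : σ → σ → Matrix σ ρ ℝ)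
    (G : ρ → Matrix σ σ ℝ) (G₂ : ρ → σ → Matrix σ σ ℝ) (H : ρ → σ → Matrix σ σ ℝ)
    (hG : ∀ a m j, G a m j = X₁ j m a) (hG₂ : ∀ a l m j, G₂ a l m j = X₂ l j m a) (hH : ∀ a i j k, H a i j k = X₂ j k i a)
    (hC2 : ∀ a l, ∑ i, Ŵ₀ i a • 𝕄₂ i l + ∑ i, X₁ l i a • 𝕄₁ i
      = -((G₂ a l)ᵀ * 𝕄₀ + 𝕄₀ * G₂ a l) - ((G a)ᵀ * 𝕄₁ l + 𝕄₁ l * G a) - ∑ i, 𝕄₀ i l • H a i)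
    (hslot₁ : ∀ k j i, 𝕄₁ k j i = 𝕄₁ i j k) (hslot₂ : ∀ i l j k, 𝕄₂ i l j k = 𝕄₂ k l j i) (hX₂ : ∀ k l, X₂ k l = X₂ l k)
    (k l : σ) :
    𝕄₂ k l * Ŵ₀ + 𝕄₁ k * X₁ l + 𝕄₁ l * X₁ k + 𝕄₀ * X₂ k l
      + oslot X₁ (fun i => 𝕄₁ l i k) + oslot (X₂ l) (fun i => 𝕄₀ i k) + oslot (X₂ k) (fun i => 𝕄₀ i l) = 0 := by
  ext j a
  have h := congrFun (congrFun (hC2 a l) j) k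
  simp only [Matrix.add_apply, Matrix.sum_apply, Matrix.smul_apply, smul_eq_mul, Matrix.neg_apply, Matrix.sub_apply,
    Matrix.mul_apply, Matrix.transpose_apply, hG, hG₂, hH] at h
  simp only [Matrix.add_apply, Matrix.mul_apply, oslot_apply, Matrix.zero_apply]
  have e1 : ∑ i, 𝕄₂ k l j i * Ŵ₀ i a = ∑ i, Ŵ₀ i a * 𝕄₂ i l j k :=
    Finset.sum_congr rfl fun i _ => by rw [hslot₂ i l j k, mul_comm]
  have e2 : ∑ i, 𝕄₁ k j i * X₁ l i a = ∑ i, X₁ l i a * 𝕄₁ i j k :=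
    Finset.sum_congr rfl fun i _ => by rw [hslot₁ k j i, mul_comm]
  have e4 : ∑ i, 𝕄₀ j i * X₂ k l i a = ∑ i, 𝕄₀ j i * X₂ l k i a := by rw [hX₂ k l]
  have e5 : ∑ i, 𝕄₁ l i k * X₁ j i a = ∑ i, X₁ j i a * 𝕄₁ l i k := Finset.sum_congr rfl fun i _ => mul_comm _ _
  have e6 : ∑ i, 𝕄₀ i k * X₂ l j i a = ∑ i, X₂ l j i a * 𝕄₀ i k := Finset.sum_congr rfl fun i _ => mul_comm _ _
  have e7 : ∑ i, 𝕄₀ i l * X₂ k j i a = ∑ i, 𝕄₀ i l * X₂ j k i a := by rw [hX₂ k j]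
  rw [e1, e2, e4, e5, e6, e7]
  linarith

end Bridge


/-! ## §4 The read-out on `ν ⊕ μ`: binders `aₛ`, `bₛ` of `hessT_sliceTransfer_jets` verbatim (order one) -/

section Unpacked

variable {ν μ ρ : Type*} [Fintype ν] [Fintype μ]

/-- [folklore] `kkt K Q` acting on a field-rows matrix: `kkt K Q · [W; 0] = [K·W; Q·W]`. -/
theorem kkt_mul_fromRows_zero (K : Matrix ν ν ℝ) (Q : Matrix μ ν ℝ) (W : Matrix ν ρ ℝ) :
    kkt K Q * fromRows W (0 : Matrix μ ρ ℝ) = fromRows (K * W) (Q * W) := by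
  rw [kkt, Matrix.fromBlocks_mul_fromRows]
  simp

omit [Fintype ν] [Fintype μ] in
/-- [folklore] A rows-partitioned matrix vanishes iff both blocks do. -/
theorem fromRows_eq_zero_iff (A : Matrix ν ρ ℝ) (B : Matrix μ ρ ℝ) : fromRows A B = 0 ↔ A = 0 ∧ B = 0 := by
  rw [← Matrix.fromRows_zero]
  exact ⟨fun h => Matrix.fromRows_inj h, fun h => by rw [h.1, h.2]⟩

omit [Fintype ν] [Fintype μ] in
/-- [folklore] Sum of two rows-partitioned matrices, blockwise. -/
theorem fromRows_add_fromRows (A C : Matrix ν ρ ℝ) (B D : Matrix μ ρ ℝ) :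
    fromRows A B + fromRows C D = fromRows (A + C) (B + D) := by
  ext i a
  rcases i with i | i <;> simp [Matrix.fromRows]

omit [Fintype ν] [Fintype μ] in
/-- [folklore] Weighted sums of `kkt`-tables are `kkt` of the weighted sums (the double-sum version is the same `ext`∕`simp`). -/
theorem sum_smul_kkt {ι : Type*} (s : Finset ι) (c : ι → ℝ) (K : ι → Matrix ν ν ℝ) (Q : ι → Matrix μ ν ℝ) :
    ∑ k ∈ s, c k • kkt (K k) (Q k) = kkt (∑ k ∈ s, c k • K k) (∑ k ∈ s, c k • Q k) := by
  ext i j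
  rcases i with i | i <;> rcases j with j | j <;> simp [kkt, Matrix.fromBlocks, Matrix.sum_apply]

omit [Fintype ν] [Fintype μ] in
/-- [folklore] Weighted sums of field-rows tables are field-rows tables of the weighted sums. -/
theorem sum_smul_fromRows_zero {ι : Type*} (s : Finset ι) (c : ι → ℝ) (x : ι → Matrix ν ρ ℝ) :
    ∑ k ∈ s, c k • fromRows (x k) (0 : Matrix μ ρ ℝ) = fromRows (∑ k ∈ s, c k • x k) (0 : Matrix μ ρ ℝ) := by
  ext i a
  rcases i with i | i <;> simp [Matrix.sum_apply, Matrix.fromRows]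

/-- [folklore] `oslot` of a field-rows generator family against a weight with NO FIELD ROWS vanishes («generators have no multiplier
rows, the source sits in the multiplier rows»). -/
theorem oslot_fromRows_zero_eq_zero (x : ν ⊕ μ → Matrix ν ρ ℝ) (w : ν ⊕ μ → ℝ) (hw : ∀ i : ν, w (Sum.inl i) = 0) :
    oslot (fun k => fromRows (x k) (0 : Matrix μ ρ ℝ)) w = 0 := by
  ext j a
  simp only [oslot_apply, Matrix.zero_apply, Fintype.sum_sum_type, Matrix.fromRows_apply_inl, Matrix.fromRows_apply_inr,
    mul_zero, Finset.sum_const_zero, add_zero]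
  exact Finset.sum_eq_zero fun i _ => by rw [hw i, zero_mul]

/-- [folklore] The field rows of `kkt K₀ Q₀ *ᵥ r`, read through the splitting `r = (rᶠ, rᵐ)`: `K₀ *ᵥ rᶠ + Q₀ᵀ *ᵥ rᵐ` — the source
hypothesis of `ward₁` is the first KKT row «`K₀·U_s + Q₀ᵀ·φ_s = 0`» of the response to a prescribed coarse field. -/
theorem kkt_mulVec_inl (K₀ : Matrix ν ν ℝ) (Q₀ : Matrix μ ν ℝ) (r : ν ⊕ μ → ℝ) (i : ν) :
    (kkt K₀ Q₀ *ᵥ r) (Sum.inl i) = (K₀ *ᵥ fun j => r (Sum.inl j)) i + (Q₀ᵀ *ᵥ fun m => r (Sum.inr m)) i := by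
  simp [kkt, Matrix.mulVec, dotProduct, Matrix.fromBlocks, Fintype.sum_sum_type]

/-- [folklore] **(aₛ) AND (bₛ) FOR ASSEMBLED JETS — `packedWard₁` READ OUT.**  Tables `K₁ k`, `Q₁ k` (`k : ν ⊕ μ` — field and
multiplier directions), generator tables `x₁ k` and `W₀`, base `K₀`, `Q₀`; hypotheses: the packed off-shell Noether jet [P1] for every
direction, and a response `r` whose FIELD KKT rows vanish.  Conclusion: with `Kₛ := Σ_k r_k•K₁ k`, `Qₛ := Σ_k r_k•Q₁ k`,
`Wₛ := Σ_k r_k•x₁ k`, `Kₛ·W₀ + K₀·Wₛ = 0` and `Qₛ·W₀ + Q₀·Wₛ = 0` — binders `aₛ`∕`aₜ`, `bₛ`∕`bₜ` of `hessT_sliceTransfer_jets` verbatim.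
(`packedWard₂` reads out the same way to `aₛₜ`∕`bₛₜ`∕`aₛₛ`∕`bₛₛ`: `sum_smul_kkt` twice, `kkt_add`, four `kkt_mul_fromRows_zero`; for
symmetric `K`-tables the six `ᵀ`-binders are the same relations, the colourless placement is K-TA4C's `ColourLift.lift_rel…`.) -/
theorem ward₁ (K₀ : Matrix ν ν ℝ) (Q₀ : Matrix μ ν ℝ) (K₁ : ν ⊕ μ → Matrix ν ν ℝ) (Q₁ : ν ⊕ μ → Matrix μ ν ℝ)
    (W₀ : Matrix ν ρ ℝ) (x₁ : ν ⊕ μ → Matrix ν ρ ℝ)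
    (hP1 : ∀ k, kkt (K₁ k) (Q₁ k) * fromRows W₀ (0 : Matrix μ ρ ℝ) + kkt K₀ Q₀ * fromRows (x₁ k) (0 : Matrix μ ρ ℝ)
      + oslot (fun j => fromRows (x₁ j) (0 : Matrix μ ρ ℝ)) (fun i => kkt K₀ Q₀ i k) = 0)
    (r : ν ⊕ μ → ℝ) (hsrc : ∀ i : ν, (kkt K₀ Q₀ *ᵥ r) (Sum.inl i) = 0) :
    (∑ k, r k • K₁ k) * W₀ + K₀ * (∑ k, r k • x₁ k) = 0 ∧ (∑ k, r k • Q₁ k) * W₀ + Q₀ * (∑ k, r k • x₁ k) = 0 := by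
  have h := packedWard₁ (kkt K₀ Q₀) (fun k => kkt (K₁ k) (Q₁ k)) (fromRows W₀ 0) (fun k => fromRows (x₁ k) 0) hP1 r
    (oslot_fromRows_zero_eq_zero x₁ _ hsrc)
  rw [sum_smul_kkt, sum_smul_fromRows_zero, kkt_mul_fromRows_zero, kkt_mul_fromRows_zero, fromRows_add_fromRows,
    fromRows_eq_zero_iff] at h
  exact h

end Unpacked

end Summit.QuantumFields.BalabanUV.Beta.D1BFx.WardJetsFromNoether

end
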